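import Mathlib
import Summits.ValiantsHypothesis.ValiantsHypothesis.Theorems.RigidityForcesSymmetryRankRigidMinimalReprLaplaceFiveSeparatedCaptureLeadingMonomials
import Summits.ValiantsHypothesis.ValiantsHypothesis.Theorems.RigidityForcesSymmetryRankRigidMinimalReprLaplaceFiveSeparatedCaptureTwoK2Hub
import Summits.ValiantsHypothesis.ValiantsHypothesis.Theorems.RigidityForcesSymmetryRankRigidMinimalReprLaplaceFiveSeparatedCaptureTwoTerm

/-!
# ValiantsHypothesis / RigidityForcesSymmetry — crux `LaplaceOptimalFive` (stmt-ValiantsHypothesis-24813), symmetric capture: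
# ★ **THE LETTER-FLAT LEAF** — spans supported on one row/column (`U₀₁, U₀₂, U₁₂ ≤ x_a·V`) give `finrank W ≤ 6`

Brick 3 (part 4) of the `(2,2,2)♭` residue of the K1 lane (val-port-2 g6, 2026-08-29).  If every matrix of the three spans is supported
on the row and column of one letter `a` (as quadrics: every element is `x_a·ℓ` for a linear form `ℓ`), then by the finite form
`T_μ(p,q,r) = A_r(p,q) + B_q(p,r) + C_p(q,r)` (✓ `L3_finite_form`) every obligation vanishes on the words avoiding `a`; with
square-freeness it is determined by the six entries `T_μ(a,q,r)`, `q < r`, `q, r ≠ a`, and ✓ `hub_injective` transports the bound to `W`: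
`finrank W ≤ 6`.  This closes, for `CaptureIneqSym`, every configuration of three spans inside `x_a·V` whose finranks add up to at
least 6 — in particular the `x_a·L` nets of the common-line census of record (NOTE-port2g6-24813-common-line-residue.md, rev 2:
`u = x₀(x₄ − x₃)`, planes `⟨u, x₀ℓ_i⟩`, pairwise prolongations (3,3,3), outside the κ-count and the easy leaf).

* `vanish_of_row_supported` — support lemma.
* ★ `finrank_le_six_of_row_supported` — the count.
* ★ `captureIneqSym_of_row_supported` — the `CaptureIneqSym` conclusion when `6 ≤ Σ finrank U_i`.

Honest framing.  A small leaf; the common-line residue (pair-monomial line with all pairwise prolongations ≥ 2), every profile with a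
span of `finrank ≥ 3` outside the landed cells, `CaptureIneqSym` in general, K1 on `K₃ ⊔ K₂`, `LaplaceOptimalFive`
(OPEN · CONTESTED 72/120), `RankRigidMinimalRepr` and `VP ≠ VNP` are NOT proved here.  No definitions, no `sorry`.
-/

set_option linter.dupNamespace false
set_option autoImplicit false

namespace Summit.ValiantsHypothesis.ValiantsHypothesis.Theorems.RigidityForcesSymmetryRankRigidMinimalRepr

namespace LaplaceFiveSeparatedCapture

open Finset

/-- Support lemma: a tensor symmetric in its three slots that vanishes on the slice `(a, ·, ·)` and on every word avoiding the
letter `a` vanishes identically. [folklore] -/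
theorem vanish_of_row_supported (T : Fin 5 → Fin 5 → Fin 5 → ℂ)
    (h12 : ∀ p q r, T q p r = T p q r) (h23 : ∀ p q r, T p r q = T p q r) (a : Fin 5)
    (hslice : ∀ q r, T a q r = 0) (hoff : ∀ p q r, p ≠ a → q ≠ a → r ≠ a → T p q r = 0) : T = 0 := by
  funext p q r
  by_cases hp : p = a
  · subst hp; exact hslice q r
  by_cases hq : q = a
  · subst hq; rw [← h12]; exact hslice p r
  by_cases hr : r = a
  · subst hr; rw [← h23, ← h12]; exact hslice p q
  exact hoff p q r hp hq hr

/-- Indicator expansion on `Fin 5 × Fin 5`: a function supported in a finset `S` lies in the span of the indicators of `S`. [folklore] -/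
theorem mem_span_indicators_pair (g : Fin 5 × Fin 5 → ℂ) (S : Finset (Fin 5 × Fin 5)) (hg : ∀ k, k ∉ S → g k = 0) :
    g ∈ Submodule.span ℂ (↑(S.image fun k : Fin 5 × Fin 5 => fun j : Fin 5 × Fin 5 => if k = j then (1 : ℂ) else 0) :
      Set (Fin 5 × Fin 5 → ℂ)) := by
  classical
  rw [pi_eq_sum_univ g]
  refine Submodule.sum_mem _ fun k _ => ?_
  by_cases hk : k ∈ S
  · exact Submodule.smul_mem _ _ (Submodule.subset_span (Finset.mem_coe.mpr (Finset.mem_image_of_mem _ hk)))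
  · rw [hg k hk, zero_smul]; exact Submodule.zero_mem _

/-- ★ **LETTER-FLAT COUNT.**  If every matrix of `U₀₁`, `U₀₂`, `U₁₂` is supported on the row and column of the letter `a`, then every
`W` of symmetric zero-diagonal leaf matrices captured by `L3 U₀₁ U₀₂ U₁₂` has `finrank W ≤ 6`: the obligation `T_μ` vanishes off the
letter `a` (✓ `L3_finite_form`) and is therefore determined by its six square-free entries `T_μ(a,q,r)`, `q < r`, `q, r ≠ a`
(✓ `hub_injective`). [folklore] -/
theorem finrank_le_six_of_row_supported (a : Fin 5) (U01 U02 U12 W : Submodule ℂ (Fin 5 → Fin 5 → ℂ))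
    (h01 : ∀ x ∈ U01, ∀ p q : Fin 5, p ≠ a → q ≠ a → x p q = 0)
    (h02 : ∀ x ∈ U02, ∀ p q : Fin 5, p ≠ a → q ≠ a → x p q = 0)
    (h12 : ∀ x ∈ U12, ∀ p q : Fin 5, p ≠ a → q ≠ a → x p q = 0)
    (hWs : ∀ μ ∈ W, ∀ s t : Fin 5, μ s t = μ t s) (hWd : ∀ μ ∈ W, ∀ s : Fin 5, μ s s = 0)
    (hWc : ∀ μ ∈ W, contractZ μ ∈ L3 U01 U02 U12) :
    Module.finrank ℂ W ≤ 6 := by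
  classical
  -- the read-out `T ↦ (T(a,q,r))_{q<r}`
  let ρ : (Fin 5 → Fin 5 → Fin 5 → ℂ) →ₗ[ℂ] (Fin 5 × Fin 5 → ℂ) :=
    { toFun := fun T qr => if qr.1 < qr.2 then T a qr.1 qr.2 else 0
      map_add' := fun T T' => by
        funext qr
        simp only [Pi.add_apply]
        split_ifs <;> simp
      map_smul' := fun c T => by
        funext qr
        simp only [Pi.smul_apply, smul_eq_mul, RingHom.id_apply]
        split_ifs <;> simp }
  have hρ : ∀ T qr, ρ T qr = if qr.1 < qr.2 then T a qr.1 qr.2 else 0 := fun T qr => rfl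
  let ψ : W →ₗ[ℂ] (Fin 5 × Fin 5 → ℂ) := ρ.comp (cZ.domRestrict W)
  have hψ : ∀ μ : W, ∀ qr, ψ μ qr = if qr.1 < qr.2 then contractZ μ.1 a qr.1 qr.2 else 0 := fun μ qr => rfl
  -- every obligation vanishes off the letter `a`
  have hoff : ∀ μ ∈ W, ∀ p q r, p ≠ a → q ≠ a → r ≠ a → contractZ μ p q r = 0 := by
    intro μ hμ p q r hp hq hr
    obtain ⟨A, B, C, hA, hB, hC, hT⟩ := L3_finite_form U01 U02 U12 (hWc μ hμ)
    rw [hT, h01 _ (hA r) p q hp hq, h02 _ (hB q) p r hp hr, h12 _ (hC p) q r hq hr, add_zero, add_zero]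
  -- square-freeness on the slice
  have hrep : ∀ μ : Fin 5 → Fin 5 → ℂ, ∀ q, contractZ μ a q q = 0 := fun μ q => by
    rw [← contractZ_swap12, ← contractZ_swap23]; exact contractZ_rep12 μ q a
  have hrep' : ∀ μ : Fin 5 → Fin 5 → ℂ, ∀ q, contractZ μ a a q = 0 := fun μ q => contractZ_rep12 μ a q
  have hψinj : Function.Injective ψ := by
    rw [injective_iff_map_eq_zero]
    intro μ hμ
    have h0 : ∀ q r, q < r → contractZ μ.1 a q r = 0 := fun q r hqr => by
      have := congrFun hμ (q, r)
      rw [hψ, if_pos hqr] at this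
      exact this
    have hslice : ∀ q r, contractZ μ.1 a q r = 0 := by
      intro q r
      rcases lt_trichotomy q r with hqr | hqr | hqr
      · exact h0 q r hqr
      · subst hqr; exact hrep μ.1 q
      · rw [← contractZ_swap23]; exact h0 r q hqr
    have hT0 : contractZ μ.1 = 0 :=
      vanish_of_row_supported (contractZ μ.1) (fun p q r => contractZ_swap12 μ.1 p q r)
        (fun p q r => contractZ_swap23 μ.1 p q r) a hslice (fun p q r hp hq hr => hoff μ.1 μ.2 p q r hp hq hr)
    apply Subtype.ext
    refine hub_injective μ.1 (hWs μ.1 μ.2) (hWd μ.1 μ.2) fun p q => ?_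
    simp [hT0]
  -- the image lies in the span of the six indicators of `{(q,r) : q < r, q ≠ a, r ≠ a}`
  let Z : Finset (Fin 5 × Fin 5) := Finset.univ.filter fun qr => qr.1 < qr.2 ∧ qr.1 ≠ a ∧ qr.2 ≠ a
  have hZ : Z.card ≤ 6 := by fin_cases a <;> decide
  have hψim : LinearMap.range ψ ≤
      Submodule.span ℂ (↑(Z.image fun k : Fin 5 × Fin 5 => fun j : Fin 5 × Fin 5 => if k = j then (1 : ℂ) else 0) :
        Set (Fin 5 × Fin 5 → ℂ)) := by
    rintro y ⟨μ, rfl⟩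
    refine mem_span_indicators_pair (ψ μ) Z fun k hk => ?_
    rw [hψ]
    split_ifs with hk1
    · have hk' : ¬ (k.1 ≠ a ∧ k.2 ≠ a) := fun h => hk (by simp [Z, hk1, h.1, h.2])
      by_cases hk2 : k.1 = a
      · rw [hk2]; exact hrep' μ.1 k.2
      · have hk3 : k.2 = a := by
          by_contra hk3
          exact hk' ⟨hk2, hk3⟩
        rw [hk3, ← contractZ_swap23]; exact hrep' μ.1 k.1
    · rfl
  calc Module.finrank ℂ W = Module.finrank ℂ (LinearMap.range ψ) := (LinearMap.finrank_range_of_inj hψinj).symm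
    _ ≤ Module.finrank ℂ (Submodule.span ℂ (↑(Z.image fun k : Fin 5 × Fin 5 => fun j : Fin 5 × Fin 5 =>
          if k = j then (1 : ℂ) else 0) : Set (Fin 5 × Fin 5 → ℂ))) := Submodule.finrank_mono hψim
    _ ≤ (Z.image fun k : Fin 5 × Fin 5 => fun j : Fin 5 × Fin 5 => if k = j then (1 : ℂ) else 0).card :=
          finrank_span_finset_le_card _
    _ ≤ Z.card := Finset.card_image_le
    _ ≤ 6 := hZ

/-- ★ **`CaptureIneqSym` on the letter-flat locus.**  Three symmetric spans supported on the row/column of one letter whose finranks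
add up to at least 6 (e.g. three 2-planes `⟨x_a m, x_a ℓ_i⟩` through a common line) satisfy the capture inequality. [folklore] -/
theorem captureIneqSym_of_row_supported (a : Fin 5) (U01 U02 U12 W : Submodule ℂ (Fin 5 → Fin 5 → ℂ))
    (h01 : ∀ x ∈ U01, ∀ p q : Fin 5, p ≠ a → q ≠ a → x p q = 0)
    (h02 : ∀ x ∈ U02, ∀ p q : Fin 5, p ≠ a → q ≠ a → x p q = 0)
    (h12 : ∀ x ∈ U12, ∀ p q : Fin 5, p ≠ a → q ≠ a → x p q = 0)
    (h6 : 6 ≤ Module.finrank ℂ U01 + Module.finrank ℂ U02 + Module.finrank ℂ U12)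
    (hWs : ∀ μ ∈ W, ∀ s t : Fin 5, μ s t = μ t s) (hWd : ∀ μ ∈ W, ∀ s : Fin 5, μ s s = 0)
    (hWc : ∀ μ ∈ W, contractZ μ ∈ L3 U01 U02 U12) :
    Module.finrank ℂ W ≤ Module.finrank ℂ U01 + Module.finrank ℂ U02 + Module.finrank ℂ U12 :=
  (finrank_le_six_of_row_supported a U01 U02 U12 W h01 h02 h12 hWs hWd hWc).trans h6

end LaplaceFiveSeparatedCapture

end Summit.ValiantsHypothesis.ValiantsHypothesis.Theorems.RigidityForcesSymmetryRankRigidMinimalRepr
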